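import Summits.QuantumFields.YangMills.Theorems.LuscherReductionTwistedTraceScalingBOChartSliceRep
import HarnessLib

/-!
# (C1c'-κ) TRANSFER OF THE STIFF EXPONENT FROM THE CHART COORDINATE TO THE SLICE REPRESENTATIVE: `|q(chartVec w) − q(linkEmbed p*.1)| ≤ (96t+b)·(D'(2‖x*‖ + D') + 72|E|ρ³)`
# (lane A of S-BASE, crux `TwistedTraceScaling` stmt-QuantumFields-20203, C4-CORE, the (OD) pen; item (4'') of `pub/ym-fleet/ym-luscher-20007-p1/COARSE-DESIGN.md` §28.5)

For a chart point `P(w) = c · (tubePt p*)^{P∘ξ'}` as produced by `…BOChartSliceRep.chartPoint_slice_rep` (`‖ξ'‖ ≤ 9Kρ`, `‖p*‖ ≤ (4+48K)ρ`):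
★★★ `chart_rep_transfer` — `‖linkEmbed p*.1‖ ≤ ‖chartVec w‖ + 7|E|ρ + 9BKρ + M_T(9Kρ)²` and `|q_{t,b}(chartVec w) − q_{t,b}(linkEmbed p*.1)| ≤ (96t+b)·(D'(2‖linkEmbed p*.1‖ + D') + 72|E|ρ³)`,
`D' = 9C_L K(4+48K)ρ² + 81M_T K²ρ²`: chart coordinate → relative coordinate (`…BOCentralRelLink`, constant mode invisible) → slice representative along the based orbit
(`…BOCentralRiderCancel`, the leading displacement `−∇ξ'` is a pure gauge, invisible to `q`; colour blindness for the constant factor `c`).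
★ `chartPoint_fatTube_data` — the chart point and its representative lie in the fat tube `fatTubeRho δ ρ_f β` once `√2|E|ρ < δ β` and `(3+24K)ρ ≤ ρ_f β`, and every gauge average agrees
on them.  With `ρ = O(Lβ^{-1/2}ℓ²)`, `‖chartVec w‖ = O(β^{-1/2}·polylog)`: the transfer costs `(96t+b)·O(ρ²‖chartVec w‖ + ρ³) = O(β^{-1/2}·polylog) → 0`.
HONEST FRAMING: one estimate for a stub of a child of the CONDITIONAL route R2b1; (C1c') (4') assembly, (5), rates, (C4), (C5), (B-ST) OPEN; C4-CORE OPEN; not infinite volume, not a gap, not Clay.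
-/

set_option autoImplicit false

noncomputable section

open MeasureTheory Real
open scoped BigOperators RealInnerProductSpace Matrix
open Literature.MathematicalPhysics.QuantumFieldTheory
open Literature.MathematicalPhysics.QuantumLattice

namespace Summit.QuantumFields.YangMills.Theorems.FemtoTransferGap.TwoLattice.ConstTube

open Summit.QuantumFields.YangMills.Theorems.FemtoTransferGap
open Summit.QuantumFields.YangMills.Theorems.FemtoTransferGap.TwoLattice
open Summit.QuantumFields.YangMills.Theorems.FemtoTransferGap.TwoLattice.Avg
open Summit.QuantumFields.YangMills.Theorems.FemtoTransferGap.TwoLattice.Stiff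
open Summit.QuantumFields.YangMills.Theorems.FemtoTransferGap.TwoLattice.GnChart

variable {L : ℕ} [NeZero L]

/-! ## §1 ★★★ The stiff exponent at the chart coordinate vs at the slice representative -/

/-- ★★★ **TRANSFER OF THE STIFF EXPONENT FROM THE CHART COORDINATE TO THE SLICE REPRESENTATIVE.**  For a chart point `P(w) = c · (tubePt p)^{P∘ξ'}` as produced by
`chartPoint_slice_rep` (`‖ξ'‖ ≤ 9Kρ`, `‖p‖ ≤ (4+48K)ρ`), the Taylor datum `hT` (`M_T, ε_T`), a uniform Lipschitz bound `hLip` for `basedLin q − basedLin 0` (`C_L, ε_L`), a bound `hB` on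
`‖basedLin q‖` (`B, ε_B`) and the smallness of `ρ` displayed: with `x* = linkEmbed p.1`, `D' = C_L(4+48K)ρ·9Kρ + M_T(9Kρ)²`,
`‖x*‖ ≤ ‖chartVec w‖ + 7|E|ρ + B·9Kρ + M_T(9Kρ)²` and `|q_{t,b}(chartVec w) − q_{t,b}(x*)| ≤ (96t+b)·(D'(2‖x*‖ + D') + 72|E|ρ³)`. [folklore] -/
theorem chart_rep_transfer {t : ℝ} (ht : 0 ≤ t) {b : ℝ} (hb : 0 ≤ b) {K ρ : ℝ} (hK : 0 ≤ K) (hρ0 : 0 ≤ ρ) (hρ5 : ρ ≤ 1 / 5)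
    {w : Edge 3 L → Fin 3 → ℝ} (hw : ∀ e, ∑ a, w e a ^ 2 ≤ ρ ^ 2)
    {c : SU2} {ξ' : basedSubmodule L} {p : balancedSubmodule L × (Fin 3 → Fin 3 → ℝ)}
    (hrep : latPatternChart L (fun _ => false) w = gaugeTransform (fun _ : Site 3 L => c) (gaugeTransform (fun x => chartSU2 ((ξ' : Site 3 L → Fin 3 → ℝ) x)) (tubePt L p)))
    (hξ' : ‖ξ'‖ ≤ 9 * K * ρ) (hpn : ‖p‖ ≤ (4 + 48 * K) * ρ)
    {εT MT : ℝ} (hMT : 0 ≤ MT)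
    (hT : ∀ (ξ : basedSubmodule L) (q : balancedSubmodule L × (Fin 3 → Fin 3 → ℝ)), ‖ξ‖ < εT → ‖q‖ < εT →
      ‖basedFn L (ξ, q) - basedFn L (0, q) - basedLin L q ξ‖ ≤ MT * ‖ξ‖ ^ 2)
    {CL εL : ℝ} (hCL : 0 ≤ CL)
    (hLip : ∀ q : balancedSubmodule L × (Fin 3 → Fin 3 → ℝ), ‖q‖ < εL → ∀ ξ : basedSubmodule L, ‖(basedLin L q - basedLin L 0) ξ‖ ≤ CL * ‖q‖ * ‖ξ‖)
    {B εB : ℝ} (hB0 : 0 ≤ B) (hB : ∀ q : balancedSubmodule L × (Fin 3 → Fin 3 → ℝ), ‖q‖ < εB → ‖basedLin L q‖ ≤ B)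
    (h1 : (4 + 48 * K) * ρ < εT) (h2 : (4 + 48 * K) * ρ < εL) (h3 : (4 + 48 * K) * ρ < εB) (h4 : (4 + 48 * K) * ρ ≤ 1 / 40) (h5 : 9 * K * ρ < εT) :
    let D' := CL * ((4 + 48 * K) * ρ) * (9 * K * ρ) + MT * (9 * K * ρ) ^ 2
    ‖linkEmbed L (p.1 : Edge 3 L → Fin 3 → ℝ)‖ ≤ ‖chartVec w‖ + (7 * Fintype.card (Edge 3 L) * ρ + B * (9 * K * ρ) + MT * (9 * K * ρ) ^ 2) ∧
      |stiffGaussExp L t b (chartVec w) - stiffGaussExp L t b (linkEmbed L (p.1 : Edge 3 L → Fin 3 → ℝ))| ≤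
        (96 * t + b) * (D' * (2 * ‖linkEmbed L (p.1 : Edge 3 L → Fin 3 → ℝ)‖ + D') + 72 * Fintype.card (Edge 3 L) * ρ ^ 3) := by
  intro D'
  set V := latPatternChart L (fun _ => false) w with hV
  set x' : LinkSpace L := linkEmbed L (p.1 : Edge 3 L → Fin 3 → ℝ) with hx'
  have hpT : ‖p‖ < εT := lt_of_le_of_lt hpn h1
  have hpL : ‖p‖ < εL := lt_of_le_of_lt hpn h2
  have hpB : ‖basedLin L p‖ ≤ B := hB p (lt_of_le_of_lt hpn h3)
  have hp40 : ‖p‖ ≤ 1 / 40 := hpn.trans h4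
  have hξT : ‖ξ'‖ < εT := lt_of_le_of_lt hξ' h5
  have hp1 : ‖p.1‖ ≤ 1 / 20 := (norm_fst_le p).trans (by linarith)
  have hp2 : ‖p.2‖ ≤ 1 / 40 := (norm_snd_le p).trans hp40
  have hfB0 : basedFn L (0, p) = x' := basedFn_zero_left L p hp1 hp2
  -- (ii) the size of `x*`
  obtain ⟨_, hdiff⟩ := norm_chartVec_relLinkVec_data (L := L) hρ0 hρ5 hw
  have hrel : relLinkVec L V = adL L c (basedFn L (ξ', p)) := by
    rw [hrep, relLinkVec_conj, relLinkVec_gaugeTransform_tubePt]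
  have hnormrel : ‖relLinkVec L V‖ = ‖basedFn L (ξ', p)‖ := by rw [hrel, LinearIsometryEquiv.norm_map]
  have hTay : ‖basedFn L (ξ', p) - x' - basedLin L p ξ'‖ ≤ MT * ‖ξ'‖ ^ 2 := by have h := hT ξ' p hξT hpT; rw [hfB0] at h; exact h
  have hlin : ‖basedLin L p ξ'‖ ≤ B * (9 * K * ρ) :=
    (ContinuousLinearMap.le_opNorm _ _).trans (mul_le_mul hpB hξ' (norm_nonneg _) hB0)
  have hsq : ‖ξ'‖ ^ 2 ≤ (9 * K * ρ) ^ 2 := pow_le_pow_left₀ (norm_nonneg _) hξ' 2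
  have hx'le : ‖x'‖ ≤ ‖chartVec w‖ + (7 * Fintype.card (Edge 3 L) * ρ + B * (9 * K * ρ) + MT * (9 * K * ρ) ^ 2) := by
    have e1 : x' = basedFn L (ξ', p) - basedLin L p ξ' - (basedFn L (ξ', p) - x' - basedLin L p ξ') := by abel
    have e2 : ‖x'‖ ≤ ‖basedFn L (ξ', p)‖ + ‖basedLin L p ξ'‖ + ‖basedFn L (ξ', p) - x' - basedLin L p ξ'‖ := by
      calc ‖x'‖ = ‖basedFn L (ξ', p) - basedLin L p ξ' - (basedFn L (ξ', p) - x' - basedLin L p ξ')‖ := by rw [← e1]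
        _ ≤ ‖basedFn L (ξ', p) - basedLin L p ξ'‖ + ‖basedFn L (ξ', p) - x' - basedLin L p ξ'‖ := norm_sub_le _ _
        _ ≤ _ := by gcongr; exact norm_sub_le _ _
    have e3 : ‖basedFn L (ξ', p)‖ ≤ ‖chartVec w‖ + 7 * Fintype.card (Edge 3 L) * ρ := by
      rw [← hnormrel]
      calc ‖relLinkVec L V‖ = ‖chartVec w - (chartVec w - relLinkVec L V)‖ := by rw [sub_sub_cancel]
        _ ≤ ‖chartVec w‖ + ‖chartVec w - relLinkVec L V‖ := norm_sub_le _ _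
        _ ≤ _ := by gcongr
    have e4 : MT * ‖ξ'‖ ^ 2 ≤ MT * (9 * K * ρ) ^ 2 := mul_le_mul_of_nonneg_left hsq hMT
    linarith
  refine ⟨hx'le, ?_⟩
  -- (i) the transfer: chart coordinate → relative coordinate → slice representative
  have hA := abs_stiffGaussExp_relLinkVec_sub_chart_le (L := L) ht hb hρ0 hρ5 hw
  rw [← hV] at hA
  obtain ⟨_, hB'⟩ := stiffGaussExp_constBased_orbit (L := L) ht hb p hMT hT hCL (hLip p hpL) hpT hp40 hξT c
  rw [← hrep] at hB'
  -- monotonicity of the orbit bound in `D'`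
  set Da : ℝ := CL * ‖p‖ * ‖ξ'‖ + MT * ‖ξ'‖ ^ 2 with hDa
  have hDa0 : 0 ≤ Da := by positivity
  have hDale : Da ≤ D' := by
    have e1 : CL * ‖p‖ * ‖ξ'‖ ≤ CL * ((4 + 48 * K) * ρ) * (9 * K * ρ) := by
      have := mul_le_mul hpn hξ' (norm_nonneg _) (by positivity : (0 : ℝ) ≤ (4 + 48 * K) * ρ)
      calc CL * ‖p‖ * ‖ξ'‖ = CL * (‖p‖ * ‖ξ'‖) := by ring
        _ ≤ CL * ((4 + 48 * K) * ρ * (9 * K * ρ)) := mul_le_mul_of_nonneg_left this hCL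
        _ = _ := by ring
    have e2 : MT * ‖ξ'‖ ^ 2 ≤ MT * (9 * K * ρ) ^ 2 := mul_le_mul_of_nonneg_left hsq hMT
    show CL * ‖p‖ * ‖ξ'‖ + MT * ‖ξ'‖ ^ 2 ≤ CL * ((4 + 48 * K) * ρ) * (9 * K * ρ) + MT * (9 * K * ρ) ^ 2
    linarith
  have hmono : (96 * t + b) * Da * (2 * ‖x'‖ + Da) ≤ (96 * t + b) * (D' * (2 * ‖x'‖ + D')) := by
    have h0 : 0 ≤ 96 * t + b := by positivity
    have := mul_le_mul hDale (by linarith : 2 * ‖x'‖ + Da ≤ 2 * ‖x'‖ + D') (by positivity) (hDa0.trans hDale)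
    calc (96 * t + b) * Da * (2 * ‖x'‖ + Da) = (96 * t + b) * (Da * (2 * ‖x'‖ + Da)) := by ring
      _ ≤ _ := mul_le_mul_of_nonneg_left this h0
  have htri := abs_sub_le (stiffGaussExp L t b (chartVec w)) (stiffGaussExp L t b (relLinkVec L V)) (stiffGaussExp L t b x')
  rw [abs_sub_comm] at hA
  calc _ ≤ |stiffGaussExp L t b (chartVec w) - stiffGaussExp L t b (relLinkVec L V)| + |stiffGaussExp L t b (relLinkVec L V) - stiffGaussExp L t b x'| := htri
    _ ≤ 72 * Fintype.card (Edge 3 L) * (96 * t + b) * ρ ^ 3 + (96 * t + b) * Da * (2 * ‖x'‖ + Da) := add_le_add hA hB'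
    _ ≤ 72 * Fintype.card (Edge 3 L) * (96 * t + b) * ρ ^ 3 + (96 * t + b) * (D' * (2 * ‖x'‖ + D')) := by linarith [hmono]
    _ = (96 * t + b) * (D' * (2 * ‖x'‖ + D') + 72 * Fintype.card (Edge 3 L) * ρ ^ 3) := by ring

/-! ## §2 Fat-tube membership of a chart point and of its representative -/

/-- ★ **Chart points and their representatives are fat-tube points.**  If `√2·|E|·ρ < δ β` and `√2·ρ < ρ_f β` then `P(w) ∈ fatTubeRho δ ρ_f β`; if moreover `P(w) = c·(tubePt p)^{P∘ξ'}` with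
`1 − ((2+24K)ρ)²/4 ≤ scalarPart((tubePt p)_e)` and `(2+24K)ρ < ρ₁`, then `tubePt p ∈ fatTubeRho δ (fun _ ↦ ρ₁) β` and `gaugeAvg φ (tubePt p) = gaugeAvg φ (P w)` for every `φ`. [folklore] -/
theorem chartPoint_fatTube_data {K ρ : ℝ} (hK : 0 ≤ K) (hρ0 : 0 ≤ ρ) {w : Edge 3 L → Fin 3 → ℝ} (hw : ∀ e, ∑ a, w e a ^ 2 ≤ ρ ^ 2)
    {δ ρf : ℝ → ℝ} {β : ℝ} (hδ : Real.sqrt 2 * Fintype.card (Edge 3 L) * ρ < δ β) (hρf : Real.sqrt 2 * ρ < ρf β)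
    {c : SU2} {ξ' : basedSubmodule L} {p : balancedSubmodule L × (Fin 3 → Fin 3 → ℝ)}
    (hrep : latPatternChart L (fun _ => false) w = gaugeTransform (fun _ : Site 3 L => c) (gaugeTransform (fun x => chartSU2 ((ξ' : Site 3 L → Fin 3 → ℝ) x)) (tubePt L p)))
    (hsc : ∀ e : Edge 3 L, 1 - ((2 + 24 * K) * ρ) ^ 2 / 4 ≤ scalarPart (tubePt L p e)) {ρ₁ : ℝ} (hρ₁ : (2 + 24 * K) * ρ < ρ₁) :
    latPatternChart L (fun _ => false) w ∈ fatTubeRho L δ ρf β ∧ tubePt L p ∈ fatTubeRho L δ (fun _ => ρ₁) β ∧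
      ∀ φ : GaugeConfig 3 L SU2 → ℝ, gaugeAvg φ (tubePt L p) = gaugeAvg φ (latPatternChart L (fun _ => false) w) := by
  obtain ⟨_, hfrob, horb⟩ := latPatternChart_near_data (L := L) hρ0 hw
  have horb' : orbitDist (latPatternChart L (fun _ => false) w) < δ β := by
    refine lt_of_le_of_lt horb ?_
    calc (Fintype.card (Edge 3 L) : ℝ) * (Real.sqrt 2 * ρ) = Real.sqrt 2 * Fintype.card (Edge 3 L) * ρ := by ring
      _ < δ β := hδ
  have hV : latPatternChart L (fun _ => false) w ∈ fatTubeRho L δ ρf β := ⟨fun e => lt_of_le_of_lt (hfrob e) hρf, horb'⟩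
  obtain ⟨hfat, -, havg⟩ := tubePt_rep_data (L := L) (δ := δ) hrep (by positivity : (0 : ℝ) ≤ (2 + 24 * K) * ρ) hρ₁ hsc horb'
  exact ⟨hV, hfat, havg⟩

end Summit.QuantumFields.YangMills.Theorems.FemtoTransferGap.TwoLattice.ConstTube

end
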